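import Summits.ValiantsHypothesis.ValiantsHypothesis.Theorems.SoloBlindPlusLadderTerm

/-!
# The `+`-ladder above the permanent is a theorem down to `M = n^{ω(1)}`

(Part III, the bound; parts I–II are `SoloBlindPlusLadderDefs` — the rung polynomial and the
permutation mass — and `SoloBlindPlusLadderTerm` — the per-term estimate.)

Write `F_{n,n} := ∏_i ∑_j x_{i,j}` (the full set-multilinear polynomial, all maps `[n] → [n]`)
and `per_n := ∑_{σ ∈ S_n} ∏_i x_{i,σ(i)}`.  Over `ℂ`, `VP ≠ VNP` holds iff `per ∉ VP`, iff (by one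
subtraction, `per = ((F + M·per) - F)/M`) the monotone-easy polynomial `F_{n,n} + M · per_n` is
monotone-HARD for every fixed `M > 0` however small.  These files prove the trivial end of that
ladder with an exact threshold: by mass counting on the permutation monomials and one
Cauchy–Schwarz inequality over image classes,

  every monotone (i.e. `ℝ≥0`) fan-in-two circuit computing `F_{n,n} + M · per_n`, `n ≥ 3`, has
  size `s` with  `2^{⌈n/3⌉} · √(1+M) ≤ 4 s (n+1)² · (√(1+M) + 2^{⌈n/3⌉})`,  hence
  `s ≥ min(2^{⌈n/3⌉}, √(1+M)) / (8 (n+1)²)`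

(`PlusLadder.monotone_size_lower_bound`, `soloBlind_plusLadder_lower_bound`).  So the bound is
super-polynomial for every `M = n^{ω(1)}` and `2^{Ω(n)}` for `M ≥ 4^{n/3}`; at `M = ∞` it is
Jerrum–Snir's bound for the permanent, and the method provably stops at `√M` (the summand
`F_{n,n}` is itself an admissible product carrying a `1/(1+M)` fraction of the permutation
mass).  The open content of the ladder is exactly the range `M ≤ n^{O(1)}`, ending in Valiant's
hypothesis as `M → 0⁺`.

Proof.  The structure theorem (`ArithCircuit.exists_balanced_decomposition`,
`MonotoneStructure.lean`) writes `g := F + M per = ∑_{t ≤ T} a_t b_t`, `T ≤ 4 s (n+1)²`, with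
`a_t` ordered on a row set `A_t`, `n < 3|A_t| ≤ 2n`, `b_t` on `A_tᶜ`, `a_t b_t ≤ g`.  Let
`μ(p) := ∑_{ν bijective} p(x_ν)`; `μ(g) ≥ n!(1+M)`.  For one term `ab`, `|A| = k`, group Alice's
injective maps `τ` by their image `S` and Bob's injective `θ` by the complement of their image:
`u_S := ∑ a_τ`, `v_S := ∑ b_θ`.  Then `μ(ab) = ∑_S u_S v_S`, each `u_S v_S ≤ k!(n-k)!(1+M) =: Z`
(at most `k!(n-k)!` pairs, each coefficient `≤ 1+M`), and
`(∑_S √(u_S v_S))² ≤ (∑ u_S)(∑ v_S) = μ(ab) + (cross pairs) ≤ μ(ab) + N`, `N := #{(τ,θ) injective}`,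
because a cross pair glues to a non-bijection, where `g` has coefficient `1`.  Hence
`μ(ab)² ≤ Z (μ(ab) + N)`, `μ(ab) ≤ Z + √(Z N) ≤ k!(n-k)!(1+M) + n! √(1+M)`, and
`k!(n-k)! ≤ n!/2^{⌈n/3⌉}` by `2^j ≤ C(n,k)` for `j ≤ min(k, n-k)`.  Summing over the `T` terms gives
the claim.  Elementary; written out because the boundary of what is known on this exact ladder is
then a number (`√M`) rather than an adjective.

References: M. Jerrum, M. Snir, J. ACM 29 (1982) (the case `M = ∞`); the structure theorem as in
Chattopadhyay–Datta–Ghosal–Mukhopadhyay, ITCS 2022 (arXiv:2109.06941) §2 Thm 2.1; P. Hrubeš,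
comput. complexity 29 (2020) Thm 1 (the exact bridge `VP` ↔ `ε`-sensitive monotone bounds).
-/

noncomputable section

open scoped NNReal Nat Classical
open MvPolynomial Finset Literature.Computability.AlgebraicComplexity

namespace Summit.ValiantsHypothesis.ValiantsHypothesis.Theorems

namespace PlusLadder

variable {n : ℕ}

/-! ### The lower bound -/

/-- **Theorem A.**  Every monotone fan-in-two circuit computing `F_{n,n} + M · per_n` (`n ≥ 3`)
has size `s` with `2^{⌈n/3⌉} √(1+M) ≤ 4 s (n+1)² (√(1+M) + 2^{⌈n/3⌉})`. -/
theorem monotone_size_lower_bound (hn : 3 ≤ n) (M : ℝ≥0)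
    (P : ArithCircuit ℝ≥0 (Fin n × Fin n)) (hP : P.IsFanInTwo)
    (hc : P.Computes (ladder n M)) :
    (2 : ℝ) ^ ((n + 2) / 3) * Real.sqrt (1 + M) ≤
      4 * P.size * (n + 1) ^ 2 * (Real.sqrt (1 + M) + 2 ^ ((n + 2) / 3)) := by
  have hn' : 3 ≤ Fintype.card (Fin n) := by rwa [Fintype.card_fin]
  obtain ⟨L, hlen, hsum, hL⟩ :=
    ArithCircuit.exists_balanced_decomposition P hP hc (isFullyOrdered_ladder M) hn'
  rw [Fintype.card_fin] at hlen hL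
  have hQ2 : Real.sqrt (1 + (M : ℝ)) ^ 2 = 1 + (M : ℝ) := Real.sq_sqrt (by positivity)
  have hQpos : 0 < Real.sqrt (1 + (M : ℝ)) := Real.sqrt_pos.2 (by positivity)
  have hDpos : (0 : ℝ) < (2 : ℝ) ^ ((n + 2) / 3) := by positivity
  set Q := Real.sqrt (1 + (M : ℝ)) with hQ
  set D : ℝ := (2 : ℝ) ^ ((n + 2) / 3) with hD
  have hD0 : D ≠ 0 := hDpos.ne'
  -- per-term bound
  set B : ℝ := (n ! : ℝ) * (1 + M) / D + n ! * Q with hB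
  have hterm : ∀ x ∈ (L.map fun t => t.2.1 * t.2.2).map mass, x ≤ B := by
    intro x hx
    rw [List.map_map, List.mem_map] at hx
    obtain ⟨t, ht, rfl⟩ := hx
    obtain ⟨ha, hb, h1, h2, hle⟩ := hL t ht
    have hm := mass_term_le ha hb hle
    have hf := factorial_mul_factorial_mul_two_pow_le h1 h2
    have h0 : (0 : ℝ) ≤ 1 + (M : ℝ) := by positivity
    show mass (t.2.1 * t.2.2) ≤ B
    calc mass (t.2.1 * t.2.2)
        ≤ (t.1.card ! * (n - t.1.card) ! : ℝ) * (1 + M) + n ! * Q := hm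
      _ ≤ (n ! : ℝ) / D * (1 + M) + n ! * Q := by
          gcongr
          rw [le_div_iff₀ hDpos]; exact hf
      _ = B := by rw [hB]; ring
  -- sum up
  have hmass : mass (ladder n M) = ((L.map fun t => t.2.1 * t.2.2).map mass).sum := by
    rw [← hsum, mass_list_sum]
  have hsumle : mass (ladder n M) ≤ (L.length : ℝ) * B := by
    rw [hmass]
    have := List.sum_le_card_nsmul _ B hterm
    rw [List.length_map, List.length_map, nsmul_eq_mul] at this
    exact this
  have hT : (L.length : ℝ) ≤ 4 * P.size * (n + 1) ^ 2 := by exact_mod_cast hlen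
  have hlow := mass_ladder_ge (n := n) M
  have hfac : (0 : ℝ) < n ! := by exact_mod_cast Nat.factorial_pos n
  have h1 : (1 + (M : ℝ)) ≤ L.length * ((1 + M) / D + Q) := by
    have := hlow.trans hsumle
    rw [hB] at this
    have h' : (n ! : ℝ) * (1 + M) ≤ n ! * (L.length * ((1 + M) / D + Q)) := by
      calc (n ! : ℝ) * (1 + M) ≤ L.length * ((n ! : ℝ) * (1 + M) / D + n ! * Q) := this
        _ = n ! * (L.length * ((1 + M) / D + Q)) := by ring
    exact le_of_mul_le_mul_left h' hfac
  have h2 : D * Q * Q ≤ L.length * (Q + D) * Q := by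
    have := mul_le_mul_of_nonneg_left h1 hDpos.le
    rw [← hQ2] at this
    have e : D * (L.length * (Q ^ 2 / D + Q)) = L.length * (Q + D) * Q := by
      field_simp
    calc D * Q * Q = D * Q ^ 2 := by ring
      _ ≤ D * (L.length * (Q ^ 2 / D + Q)) := this
      _ = L.length * (Q + D) * Q := e
  have h3 : D * Q ≤ L.length * (Q + D) := le_of_mul_le_mul_right h2 hQpos
  calc D * Q ≤ L.length * (Q + D) := h3
    _ ≤ 4 * P.size * (n + 1) ^ 2 * (Q + D) :=
        mul_le_mul_of_nonneg_right hT (by positivity)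

/-- Corollary: `min(2^{⌈n/3⌉}, √(1+M)) ≤ 8 s (n+1)²`. -/
theorem min_le_size (hn : 3 ≤ n) (M : ℝ≥0)
    (P : ArithCircuit ℝ≥0 (Fin n × Fin n)) (hP : P.IsFanInTwo)
    (hc : P.Computes (ladder n M)) :
    min ((2 : ℝ) ^ ((n + 2) / 3)) (Real.sqrt (1 + M)) ≤ 8 * P.size * (n + 1) ^ 2 := by
  have h := monotone_size_lower_bound hn M P hP hc
  have hD : (0 : ℝ) < (2 : ℝ) ^ ((n + 2) / 3) := by positivity
  have hQ : 0 < Real.sqrt (1 + (M : ℝ)) := Real.sqrt_pos.2 (by positivity)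
  have hT0 : (0 : ℝ) ≤ 4 * P.size * (n + 1) ^ 2 := by positivity
  set D : ℝ := (2 : ℝ) ^ ((n + 2) / 3)
  set Q := Real.sqrt (1 + (M : ℝ))
  set T : ℝ := 4 * P.size * (n + 1) ^ 2
  have hmin : min D Q * (Q + D) ≤ 2 * (D * Q) := by
    rcases le_total D Q with hDQ | hQD
    · rw [min_eq_left hDQ]; nlinarith
    · rw [min_eq_right hQD]; nlinarith
  have h' : min D Q * (Q + D) ≤ 2 * T * (Q + D) := by nlinarith
  have hQD : 0 < Q + D := by positivity
  have := le_of_mul_le_mul_right h' hQD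
  linarith

end PlusLadder

/-- **The `+`-ladder rung (solo-blind).**  For `n ≥ 3` and every `M ≥ 0`, a monotone fan-in-two
arithmetic circuit over `ℝ≥0` computing `∏_i ∑_j x_{ij} + M · per_n` has size at least
`min(2^{⌈n/3⌉}, √(1+M)) / (8 (n+1)²)`. -/
theorem soloBlind_plusLadder_lower_bound {n : ℕ} (hn : 3 ≤ n) (M : ℝ≥0)
    (P : ArithCircuit ℝ≥0 (Fin n × Fin n)) (hP : P.IsFanInTwo)
    (hc : P.Computes ((∏ i : Fin n, ∑ j : Fin n, X (i, j)) +
      C M * ∑ σ : Equiv.Perm (Fin n), ∏ i, X (i, σ i))) :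
    min ((2 : ℝ) ^ ((n + 2) / 3)) (Real.sqrt (1 + M)) ≤ 8 * P.size * (n + 1) ^ 2 := by
  rw [← PlusLadder.fullSML_eq_prod_sum, ← PlusLadder.perNN_eq_sum_prod] at hc
  exact PlusLadder.min_le_size hn M P hP hc

end Summit.ValiantsHypothesis.ValiantsHypothesis.Theorems
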